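import Literature.Probability.RandomPlanarGeometry.HexSAWBrickWallSlabStrict
import Literature.Probability.RandomPlanarGeometry.HexSAWRotStripDictionary
import HarnessLib

/-!
# Beaton's perpendicular slabs are summable at `x_c`: the rotated-frame consumer form of «HEX-ARMCHAIR-SLAB-SUBCRIT»

Topic `Literature/Probability/RandomPlanarGeometry` (continues `HexSAWBrickWallSlabStrict.lean` — `HexBW.summable_slabCount_mul_pow :
Σ_n c_n(Slab_H) x_c^n < ∞` for the column slabs `Slab_H = {0,…,H} × ℤ` of the brick wall, `H ≥ 1` — and the rotated dictionary
`HexSAWRotStripDictionary.lean` — `HV.rho`, `xi (rho v) = −ht v`).  In Beaton's rotated honeycomb frame (N. R. Beaton, *J. Phys. A* 47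
(2014), arXiv:1210.0274v3, §2 Fig. 1: heights `ξ`) the slab `{1 ≤ −ξ ≤ H₀}` is, through `ρ⁻¹` and the brick-wall chart `hvToBW`
(`ht = x₀`), inside the column slab `{0 ≤ x₀ ≤ max H₀ 1}`; so the number of `k`-step self-avoiding walks confined to it, from ANY
start, is at most `c_k(Slab_{max H₀ 1})`, whose generating series converges at `x_c`.

## Main statement (lane «pcv-sawmu»; the adapter between door R100 and a-p6 g7's `rotELimZeroY_of_slabSummable`)

* `rhoInv` (the inverse rotation, `rho_rhoInv`, `rhoInv_adj`, `ht_rhoInv : ht (rhoInv u) = −xi u`), `toSlabBW`, `toSlabPair`,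
  `toSlabPair_mem`, `toSlabPair_inj`, `card_rotSlabSAWs_le : #{k-step SAWs from s in 1 ≤ −ξ ≤ H₀} ≤ c_k(Slab_{max H₀ 1})`;
* **`rotSlabWalks_summable (H₀ : ℕ) : ∃ F : ℕ → ℝ, Summable F ∧ ∀ s k, #{…} · x_c^k ≤ F k`** — a-p6 g7's face
  `RotSlabWalksSummable H₀` (`HexSAWRotStripLateralNullY.lean`, stated with `slabSAWs H₀ s k := (sawFin s k).filter …`) by `Iff.rfl`.
-/

noncomputable section

open Finset Literature.Probability.LatticeModels Literature.Probability.Percolation SimpleGraph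

namespace Literature.Probability.RandomPlanarGeometry.SAW.HV

/-! ### The inverse rotation and the chart to the brick-wall column slabs -/

/-- The inverse of the rotation `ρ`: `(p, q, c) ↦ (−q − p − bit, p, c)`. [cite: Beaton2014RotatedHoneycomb, §2 (Fig. 1)] -/
def rhoInv (u : HV) : HV := (-u.2.1 - u.1 - bit u, u.1, u.2.2)

/-- `ρ ∘ ρ⁻¹ = id`. [cite: Beaton2014RotatedHoneycomb, §2 (Fig. 1)] -/
theorem rho_rhoInv (u : HV) : rho (rhoInv u) = u := by
  obtain ⟨a, b, c⟩ := u
  cases c <;> simp [rho, rhoInv, bit]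
  omega

/-- `ρ⁻¹` preserves adjacency. [cite: Beaton2014RotatedHoneycomb, §2 (Fig. 1)] -/
theorem rhoInv_adj {u v : HV} (h : hvGraph.Adj u v) : hvGraph.Adj (rhoInv u) (rhoInv v) := by
  obtain ⟨a, b, c⟩ := u
  obtain ⟨a', b', c'⟩ := v
  cases c <;> cases c' <;> simp [hvGraph_adj, AdjRel, rhoInv, bit] at h ⊢ <;> omega

/-- `ρ⁻¹` is injective. [cite: Beaton2014RotatedHoneycomb, §2 (Fig. 1)] -/
theorem rhoInv_injective : Function.Injective rhoInv := fun u v h => by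
  rw [← rho_rhoInv u, ← rho_rhoInv v, h]

/-- Beaton's height is the brick-wall height after `ρ⁻¹`: `ht (ρ⁻¹ u) = −ξ u`. [cite: Beaton2014RotatedHoneycomb, §2 (Fig. 1)] -/
theorem ht_rhoInv (u : HV) : ht (rhoInv u) = -xi u := by
  have := xi_rho (rhoInv u)
  rw [rho_rhoInv] at this
  omega

/-- The chart to the brick wall after `ρ⁻¹`: coordinate `0` is `−ξ`. [cite: Beaton2014RotatedHoneycomb, §2 (Fig. 1)] -/
def toSlabBW (u : HV) : Site 2 := bwIso.symm (rhoInv u)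

/-- Coordinate `0` of the chart is `−ξ`. [cite: Beaton2014RotatedHoneycomb, §2 (Fig. 1)] -/
theorem toSlabBW_zero (u : HV) : toSlabBW u 0 = -xi u := by
  rw [toSlabBW, bwIso_symm_apply, ← ht_eq_hvToBW, ht_rhoInv]

/-- The chart is injective. [cite: Beaton2014RotatedHoneycomb, §2 (Fig. 1)] -/
theorem toSlabBW_injective : Function.Injective toSlabBW :=
  fun _ _ h => rhoInv_injective (bwIso.symm.injective h)

/-- The chart carries edges of `ℍ` to brick-wall bonds. [cite: Beaton2014RotatedHoneycomb, §2 (Fig. 1)] -/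
theorem toSlabBW_adj {u v : HV} (h : hvGraph.Adj u v) : brickWallGraph.Adj (toSlabBW u) (toSlabBW v) :=
  (bwIso.symm.map_rel_iff).2 (rhoInv_adj h)

/-! ### Transfer: self-avoiding lists of the slab `1 ≤ −ξ ≤ H₀` ↦ `HexBW.slabPairs` -/

/-- The brick-wall copy of a honeycomb vertex list. [cite: MadrasSlade1993, §8.2, eq. (8.2.1)] -/
def toSlabList (l : List HV) : List (Site 2) := l.map toSlabBW

/-- The slab pair of a honeycomb vertex list: (cross-section representative of its start, translate started at the origin).
[cite: MadrasSlade1993, §8.2, eq. (8.2.1)] -/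
def toSlabPair (l : List HV) : Site 2 × (ℕ → Site 2) :=
  (HexBW.vnorm ((toSlabList l).headD 0),
    fun s => HexBW.StripInsertion.ofList (toSlabList l) s - (toSlabList l).headD 0)

/-- `toSlabList` facts: non-empty, nodup, chain, head. [cite: MadrasSlade1993, §8.2] -/
theorem toSlabList_spec {l : List HV} (hl : l ≠ []) (hc : l.IsChain hvGraph.Adj) (hnd : l.Nodup) :
    toSlabList l ≠ [] ∧ (toSlabList l).Nodup ∧ (toSlabList l).IsChain brickWallGraph.Adj ∧
      (toSlabList l).head? = some ((toSlabList l).headD 0) := by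
  refine ⟨by simp [toSlabList, hl], hnd.map toSlabBW_injective, ?_, ?_⟩
  · rw [toSlabList, List.isChain_map]
    exact hc.imp fun a b h => toSlabBW_adj h
  · obtain ⟨a, l', rfl⟩ := List.exists_cons_of_ne_nil hl
    simp [toSlabList]

/-- **A self-avoiding list of `ℍ` with `0 ≤ −ξ ≤ H` on all its vertices is, after the chart and re-basing, an element of
`HexBW.slabPairs H (|l| − 1)`.** [cite: MadrasSlade1993, §8.2, eq. (8.2.1)] -/
theorem toSlabPair_mem {H : ℕ} {l : List HV} (hl : l ≠ []) (hc : l.IsChain hvGraph.Adj) (hnd : l.Nodup)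
    (hxi : ∀ w ∈ l, 0 ≤ -xi w ∧ -xi w ≤ (H : ℤ)) :
    toSlabPair l ∈ HexBW.slabPairs H (l.length - 1) := by
  obtain ⟨hne, hnd', hc', hh⟩ := toSlabList_spec hl hc hnd
  set p := (toSlabList l).headD 0 with hp
  have hlen : (toSlabList l).length = l.length := List.length_map _
  obtain ⟨hsaws, hbw⟩ := HexBW.StripInsertion.ofList_sub_mem_saws hne hnd' hc' p hh
  rw [hlen] at hsaws hbw
  have hcols : ∀ z ∈ toSlabList l, HexBW.InSlab H z := by
    intro z hz
    rw [toSlabList, List.mem_map] at hz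
    obtain ⟨w, hw, rfl⟩ := hz
    have := hxi w hw
    unfold HexBW.InSlab
    rw [toSlabBW_zero]
    exact this
  have hpmem : p ∈ toSlabList l := List.mem_of_mem_head? hh
  have hpslab : HexBW.InSlab H p := hcols p hpmem
  have heven := HexBW.vnorm_shift_even p
  rw [toSlabPair, HexBW.mem_slabPairs]
  refine ⟨HexBW.vnorm_mem_slabStarts hpslab, hsaws, ?_, ?_⟩
  · intro i hi
    have key := hbw i hi
    have e : ∀ s, HexBW.vnorm p + (HexBW.StripInsertion.ofList (toSlabList l) s - p) =
        (HexBW.vnorm p - p) + HexBW.StripInsertion.ofList (toSlabList l) s := fun s => by abel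
    dsimp only
    rw [e, e, HexBW.adj_add_left_iff_of_even]
    · exact key
    · have h2 := heven
      simp only [Pi.sub_apply] at h2 ⊢
      omega
  · intro m _
    have hmem := HexBW.StripInsertion.ofList_mem hne m
    have hin := hcols _ hmem
    have er : (HexBW.vnorm p + (HexBW.StripInsertion.ofList (toSlabList l) m - p)) 0 =
        (HexBW.StripInsertion.ofList (toSlabList l) m) 0 := by
      simp [HexBW.vnorm_apply_zero]
    unfold HexBW.InSlab at hin ⊢
    rw [er]
    exact hin

/-- The transfer is injective among lists with the same head and the same length. [cite: MadrasSlade1993, §8.2] -/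
theorem toSlabPair_inj {l l' : List HV} (hl : l ≠ []) (hl' : l' ≠ []) (hh : l.head? = l'.head?)
    (hlen : l.length = l'.length) (h : toSlabPair l = toSlabPair l') : l = l' := by
  have hmap : toSlabList l = toSlabList l' := by
    have hh' : (toSlabList l).headD 0 = (toSlabList l').headD 0 := by
      obtain ⟨a, m, rfl⟩ := List.exists_cons_of_ne_nil hl
      obtain ⟨a', m', rfl⟩ := List.exists_cons_of_ne_nil hl'
      simp only [List.head?_cons, Option.some.injEq] at hh
      simp [toSlabList, hh]
    have h2 := congrArg Prod.snd h
    simp only [toSlabPair] at h2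
    refine HexBW.StripInsertion.ofList_inj (by simp [toSlabList, hlen]) fun s => ?_
    have := congrFun h2 s
    rw [hh'] at this
    exact sub_left_inj.1 this
  exact (List.map_injective_iff.2 toSlabBW_injective) hmap

/-- **Start-uniform count**: the `k`-step self-avoiding walks from any `s` confined to `1 ≤ −ξ ≤ H₀` are at most
`c_k(Slab_{max H₀ 1})`. [cite: MadrasSlade1993, §8.2, eq. (8.2.1)] -/
theorem card_rotSlabSAWs_le (H₀ : ℕ) (s : HV) (k : ℕ) :
    ((sawFin s k).filter fun l => ∀ u ∈ l, 1 ≤ -xi u ∧ -xi u ≤ (H₀ : ℤ)).card ≤ HexBW.slabCount (max H₀ 1) k := by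
  rw [HexBW.slabCount]
  refine Finset.card_le_card_of_injOn toSlabPair (fun l hl => ?_) (fun l hl l' hl' h => ?_)
  · rw [Finset.mem_coe, Finset.mem_filter, mem_sawFin_iff, mem_sawLists_iff] at hl
    obtain ⟨⟨hc, hh, hlen, hnd⟩, hxi⟩ := hl
    have hne : l ≠ [] := by rintro rfl; simp at hlen
    have := toSlabPair_mem (H := max H₀ 1) hne hc hnd fun w hw => by
      have h := hxi w hw
      exact ⟨by omega, h.2.trans (by exact_mod_cast le_max_left H₀ 1)⟩
    rw [hlen, Nat.add_sub_cancel] at this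
    exact Finset.mem_coe.2 this
  · rw [Finset.mem_coe, Finset.mem_filter, mem_sawFin_iff, mem_sawLists_iff] at hl hl'
    have hne : l ≠ [] := by rintro rfl; simp at hl
    have hne' : l' ≠ [] := by rintro rfl; simp at hl'
    exact toSlabPair_inj hne hne' (by rw [hl.1.2.1, hl'.1.2.1]) (by rw [hl.1.2.2.1, hl'.1.2.2.1]) h

/-- **Beaton's perpendicular slabs are summable at `x_c`, uniformly in the start** (a-p6 g7's face `RotSlabWalksSummable H₀`,
verbatim up to unfolding `slabSAWs`): `F k := c_k(Slab_{max H₀ 1}) x_c^k` works, by `HexBW.summable_slabCount_mul_pow`.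
[cite: Beaton2014RotatedHoneycomb, §3, Corollary 10 (arXiv v3 p. 16: finiteness of the strip generating function at x_c — here at y = 1, by sub-criticality)] -/
theorem rotSlabWalks_summable (H₀ : ℕ) :
    ∃ F : ℕ → ℝ, Summable F ∧ ∀ (s : HV) (k : ℕ),
      (((sawFin s k).filter fun l => ∀ u ∈ l, 1 ≤ -xi u ∧ -xi u ≤ (H₀ : ℤ)).card : ℝ) * hexCriticalFugacity ^ k ≤ F k :=
  ⟨fun k => (HexBW.slabCount (max H₀ 1) k : ℝ) * hexCriticalFugacity ^ k,
    HexBW.summable_slabCount_mul_pow (le_max_right H₀ 1), fun s k =>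
      mul_le_mul_of_nonneg_right (by exact_mod_cast card_rotSlabSAWs_le H₀ s k)
        (pow_nonneg hexCriticalFugacity_pos_lt_one.1.le k)⟩

end Literature.Probability.RandomPlanarGeometry.SAW.HV
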